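import Summits.NavierStokesRegularity.NavierStokesRegularity.Theses.EulerMelnikovDss

/-!
# Route EulerMelnikovDss — glue of the decomposition of the deciding crux `FastBranchProfiles`
  (stmt-NavierStokesRegularity-1414) into its three mechanism pieces

`FastBranchProfiles` (∀ δ > 0 ∃ λ ∈ (1, 1+δ) ∃ R ∈ O(3), ¬ RotatedTypeIDSSLiouville λ R — Type-I
rotated-DSS profiles with factors accumulating at `1⁺`) is the only open load-bearing binder of the
route's deciding theorem `closes`, and as an existence-of-blow-up-profiles statement it is at least
summit-strength (route re-audit 2026-08-16, Reduction axis). This file makes the route's MECHANISM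
load-bearing instead: it proves

  `PeriodicEulerSeed → FiniteMelnikovCokernel → NonlinearPersistence → FastBranchProfiles`

over the three crux items of the route (stmt-1415 admissible periodic Euler seed; stmt-13890 finite
near-1 Floquet cluster of the seed's ε-monodromies; stmt-18953 persistence of the seed along the fast
branch, stated in the NATIVE parameters of a persistence theorem — Type-I amplitudes `Cₙ → ∞` and
periods `P'ₙ → P` — with the DSS factor DERIVED as `λₙ = exp (P'ₙ / (2 Cₙ))`).

Proof: unpack the seed; discharge the finite-cluster hypothesis of `NonlinearPersistence` with
`FiniteMelnikovCokernel` at that seed; along the persisted branch the exponent `P'ₙ/(2Cₙ)` tends to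
`0` (`Tendsto.div_atTop`), so the factor tends to `1` and is eventually `< 1 + δ`, while `P'ₙ` is
eventually positive so the factor is `> 1`; a nontrivial Type-I rotated-DSS ancient mild solution with
that factor contradicts `RotatedTypeIDSSLiouville` by unfolding. (~30 lines; planner crux-strategist,
BC2 redirect of the restated deciding crux; evidence `Sketch.lean` on stmt-1414.)
-/

-- the summit and its single sub-problem share the name (CONVENTIONS §1), as in every Theorems file
set_option linter.dupNamespace false

namespace Summit.NavierStokesRegularity.NavierStokesRegularity.Theorems

open Filter Topology
open Summit.NavierStokesRegularity.NavierStokesRegularity.Theses.EulerMelnikovDss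

/-- **Glue of the decomposition of `FastBranchProfiles`** (route EulerMelnikovDss, supports
stmt-NavierStokesRegularity-1414): an admissible periodic Euler seed (`PeriodicEulerSeed`), the
finite near-1 Floquet cluster of its ε-monodromies (`FiniteMelnikovCokernel`) and nonlinear
persistence along the fast branch (`NonlinearPersistence`) give nontrivial Type-I rotated-DSS
ancient mild solutions with factors `exp (P'ₙ/(2Cₙ)) → 1⁺`, hence `FastBranchProfiles`. -/
theorem eulerMelnikovDss_fastBranchProfiles_of_pieces :
    PeriodicEulerSeed → FiniteMelnikovCokernel → NonlinearPersistence → FastBranchProfiles := by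
  intro hS hL hN
  -- the admissible seed
  obtain ⟨W, q, P, Q, hP, hE, hper, hnt, hL2, hdec, hI, hA, hH, hax⟩ := hS
  -- its finite Melnikov cokernel (linear nondegeneracy of the seed at scale ε)
  have hLc := hL W q P Q hP hE hper hnt hL2 hdec hI hA hH hax
  -- the persisted fast branch bifurcating from the seed: amplitudes C n → ∞, periods P' n → P,
  -- DSS factors exp (P' n / (2 C n))
  obtain ⟨K, C, P', R, u, hCpos, hC, hP', hbranch, -⟩ :=
    hN W q P Q hP hE hper hnt hL2 hdec hI hA hH hax hLc
  intro δ hδ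
  -- the exponent P' n / (2 C n) tends to 0 …
  have h2C : Tendsto (fun n => 2 * C n) atTop atTop := hC.const_mul_atTop (by norm_num)
  have hexp0 : Tendsto (fun n => P' n / (2 * C n)) atTop (𝓝 0) := hP'.div_atTop h2C
  -- … hence the factor tends to 1 and is eventually below 1 + δ
  have hfac : Tendsto (fun n => Real.exp (P' n / (2 * C n))) atTop (𝓝 1) := by
    have h := (Real.continuous_exp.tendsto 0).comp hexp0
    rwa [Real.exp_zero] at h
  have hlt : ∀ᶠ n in atTop, Real.exp (P' n / (2 * C n)) < 1 + δ :=
    hfac.eventually (gt_mem_nhds (by linarith))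
  -- the period is eventually positive, so the factor is eventually above 1
  have hpos : ∀ᶠ n in atTop, 0 < P' n := hP'.eventually (lt_mem_nhds hP)
  obtain ⟨n, hn1, hn2⟩ := (hlt.and hpos).exists
  obtain ⟨hmild, hmeas, hdss, hTI, -, hnontriv⟩ := hbranch n
  have hc1 : 1 < Real.exp (P' n / (2 * C n)) :=
    Real.one_lt_exp_iff.2 (div_pos hn2 (by linarith [hCpos n]))
  refine ⟨Real.exp (P' n / (2 * C n)), hc1, hn1, R n, ?_⟩
  -- a nontrivial Type-I rotated-DSS ancient mild solution refutes the rotated Liouville statement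
  intro hLiou
  exact hnontriv (hLiou hc1 (u n) hmild hmeas hdss hTI)

end Summit.NavierStokesRegularity.NavierStokesRegularity.Theorems
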